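import Summits.QuantumAdvantage.QuantumAdvantage.Theses.CubicForrelation
import Literature.Computability.QuantumComplexity.ForrelationDerivativeTables
import Literature.Computability.QuantumComplexity.ForrelationSignTransport

/-!
# Crux `CubicForrelation.NearExactIsExact` (stmt-QuantumAdvantage-14043) — fibre accounting of the almost-MM ceiling (file A)

Line `direct-sum-amplification`, stub `stub_ammAccounting` (tag AA): the generic per-fibre analysis.  The companion file
`CubicForrelationNearExactIsExactAmmAccounting.lean` adds the accounting identity and the count of bad fibres.

Setting: `g : 𝔽₂^m → {±1}`, `K = 2^m`, `W_g(y) = ∑_x g(x) (−1)^{x·y}` (`DerivativeWalsh.W`, so `∑_y W_g(y)² = K²`),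
a finite set `S` of characters and a sign pattern `σ`.  Contents (everything proved, axioms standard):
* `aa_sum_twist_mul_twist`, `aa_sum_psi_sq`: orthogonality of characters and Parseval for a signed sum
  `ψ(x) = ∑_{y∈S} ε_y (−1)^{x·y}` of DISTINCT characters, `∑_x ψ(x)² = K |S|`;
* `aa_int_ineq`, `aa_psi_int`, `aa_sum_abs_psi_le`, `aa_sum_abs_W_le`: the INTEGRALITY (LP) bound — `ψ(x)` is an
  integer `≡ |S| (mod 2)`, so `(2k+2)|ψ| ≤ ψ² + k(k+2)` pointwise for `k ≡ |S| (mod 2)`, whence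
  `(2k+2) ∑_{y∈S} |W_g(y)| ≤ K(|S| + k(k+2))` (`∑_S |W_g| = ∑_x g ψ ≤ ∑_x |ψ|` with `ε = sign W_g`);
* `aa_W_halfInt`: the aligned rank-2 quadratic `(−1)^e (−1)^{s·x}(1 + U + V − UV)/2` has all Walsh values in `(K/2)ℤ`;
* `aa_fibre` (the per-fibre lemma): if any four distinct characters of absolute Walsh mass `> 15K/8` force the Walsh
  values of `g` into `(K/2)ℤ` (the four-point lemma `stub_fourPoint` for a cubic `g`), then a fibre cost
  `K² − ∑_{y∈S} W_g(y)² + ∑_{y∈S} (σ_y W_g(y) − K/2)² < K²/8` forces `|S| = 4` and `σ_y W_g(y) = K/2` on `S`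
  (`|S| = 0` costs `K²`; `|S|` odd, `= 2`, `≥ 6` are excluded by the LP bound with `k = 1, 0, 2`; for `|S| = 4` the
  mass exceeds `15K/8` and every value `≠ K/2` in `(K/2)ℤ` costs `≥ K²/4`).

Sources (orientation only): R. O'Donnell, Analysis of Boolean Functions (CUP 2014), §1.4 (characters, Parseval);
S. Aaronson, A. Ambainis, Forrelation, SIAM J. Comput. 47 (2018), §1.1.1.
-/

set_option linter.dupNamespace false -- D-0017: single-problem summit

namespace Summit.QuantumAdvantage.QuantumAdvantage.Theorems.CubicForrelation.NearExactIsExact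

open Finset
open Literature.Computability.QuantumComplexity
open Literature.Computability.QuantumComplexity.BuzetChailloux (bxor zeroVec signOf_sq)
open Literature.Computability.QuantumComplexity.DerivativeWalsh (W)

/-! ### Characters: orthogonality and the integrality (LP) bound -/

/-- Orthogonality of characters: `∑_x (-1)^{x·y} (-1)^{x·y'} = 2^m [y = y']`. [folklore] -/
theorem aa_sum_twist_mul_twist {m : ℕ} (y y' : Fin m → Bool) :
    ∑ x : Fin m → Bool, twist x y * twist x y' = if y = y' then (2 : ℝ) ^ m else 0 := by
  have e : ∀ x : Fin m → Bool, twist x y * twist x y' = twist x (bxor y y') := fun x =>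
    (BuzetChailloux.twist_bxor_right x y y').symm
  rw [sum_congr rfl fun x _ => e x, BuzetChailloux.sum_twist_left]
  exact if_congr (BuzetChailloux.bxor_eq_zeroVec_iff y y') rfl rfl

/-- `|𝔽₂^m| = 2^m` (as a real number). [folklore] -/
theorem aa_card_univ (m : ℕ) : ((univ : Finset (Fin m → Bool)).card : ℝ) = (2 : ℝ) ^ m := by
  have h : Fintype.card (Fin m → Bool) = 2 ^ m := by simp
  rw [card_univ, h]
  push_cast
  rfl

/-- Parseval for a signed sum of DISTINCT characters:
`∑_x (∑_{y∈S} ε_y (-1)^{x·y})² = 2^m ∑_{y∈S} ε_y²`. [folklore] -/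
theorem aa_sum_psi_sq {m : ℕ} (S : Finset (Fin m → Bool)) (ε : (Fin m → Bool) → ℝ) :
    ∑ x : Fin m → Bool, (∑ y ∈ S, ε y * twist x y) ^ 2 = (2 : ℝ) ^ m * ∑ y ∈ S, ε y ^ 2 := by
  have e1 : ∀ x : Fin m → Bool, (∑ y ∈ S, ε y * twist x y) ^ 2 =
      ∑ y ∈ S, ∑ y' ∈ S, ε y * ε y' * (twist x y * twist x y') := by
    intro x
    rw [sq, sum_mul_sum]
    exact sum_congr rfl fun y _ => sum_congr rfl fun y' _ => by ring
  rw [sum_congr rfl fun x _ => e1 x, sum_comm, mul_sum]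
  refine sum_congr rfl fun y hy => ?_
  rw [sum_comm]
  have e2 : ∀ y' ∈ S, ∑ x : Fin m → Bool, ε y * ε y' * (twist x y * twist x y') =
      if y = y' then ε y * ε y' * (2 : ℝ) ^ m else 0 := by
    intro y' _
    rw [← mul_sum, aa_sum_twist_mul_twist]
    split_ifs <;> ring
  rw [sum_congr rfl e2, sum_ite_eq, if_pos hy]
  ring

/-- The integer inequality behind the LP bound: for integers `j ≡ k (mod 2)`,
`(2k+2)|j| ≤ j² + k(k+2)`, i.e. `(|j| − k)(|j| − k − 2) = 4e(e−1) ≥ 0` (only the parity of `k` matters). [folklore] -/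
theorem aa_int_ineq (j k : ℤ) (h : Even (j - k)) :
    (2 * k + 2) * |j| ≤ j ^ 2 + k * (k + 2) := by
  have key : ∀ t : ℤ, Even t → 0 ≤ t * (t - 2) := by
    intro t ht
    obtain ⟨r, rfl⟩ := ht
    rcases le_or_gt r 0 with hr | hr
    · nlinarith
    · have hr1 : (1 : ℤ) ≤ r := by omega
      nlinarith
  rcases abs_choice j with hj | hj
  · have ht : Even (|j| - k) := by rw [hj]; exact h
    have := key _ ht
    nlinarith [sq_abs j]
  · have ht : Even (|j| - k) := by
      rw [hj, show -j - k = -(j - k) - 2 * k by ring]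
      exact h.neg.sub (even_two_mul k)
    have := key _ ht
    nlinarith [sq_abs j]

/-- A signed sum of `±1`-valued characters over `S` is `|S| − 2e` for an integer `e`. [folklore] -/
theorem aa_psi_int {m : ℕ} (S : Finset (Fin m → Bool)) (ε : (Fin m → Bool) → ℝ)
    (hε : ∀ y, ε y = 1 ∨ ε y = -1) (x : Fin m → Bool) :
    ∃ e : ℤ, ∑ y ∈ S, ε y * twist x y = (S.card : ℝ) - 2 * e := by
  induction S using Finset.induction_on with
  | empty => exact ⟨0, by simp⟩
  | insert a S ha ih =>
    obtain ⟨e, he⟩ := ih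
    rw [sum_insert ha, card_insert_of_notMem ha, he]
    have h1 : ε a * twist x a = 1 ∨ ε a * twist x a = -1 := by
      rcases hε a with h | h <;> rcases Simon.twist_eq_one_or x a with h' | h' <;>
        · rw [h, h']; norm_num
    rcases h1 with h1 | h1
    · exact ⟨e, by rw [h1]; push_cast; ring⟩
    · exact ⟨e + 1, by rw [h1]; push_cast; ring⟩

/-- **Integrality bound** for a signed sum of distinct characters `ψ(x) = ∑_{y∈S} ε_y (-1)^{x·y}`: if
`|S| + k` is even then `(2k+2) ∑_x |ψ(x)| ≤ 2^m (|S| + k(k+2))` (pointwise `aa_int_ineq` — `ψ(x)` is an integer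
`≡ |S| (mod 2)` — summed with Parseval `∑_x ψ² = 2^m |S|`). [folklore] -/
theorem aa_sum_abs_psi_le {m : ℕ} (S : Finset (Fin m → Bool)) (ε : (Fin m → Bool) → ℝ)
    (hε : ∀ y, ε y = 1 ∨ ε y = -1) (k : ℕ) (hk : Even (S.card + k)) :
    (2 * k + 2 : ℝ) * ∑ x : Fin m → Bool, |∑ y ∈ S, ε y * twist x y| ≤
      (2 : ℝ) ^ m * (S.card + k * (k + 2)) := by
  have hpt : ∀ x : Fin m → Bool, (2 * k + 2 : ℝ) * |∑ y ∈ S, ε y * twist x y| ≤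
      (∑ y ∈ S, ε y * twist x y) ^ 2 + k * (k + 2) := by
    intro x
    obtain ⟨e, he⟩ := aa_psi_int S ε hε x
    have hpar : Even (((S.card : ℤ) - 2 * e) - k) := by
      obtain ⟨p, hp⟩ := hk
      refine ⟨(p : ℤ) - k - e, ?_⟩
      have hp' : ((S.card : ℤ) + k) = p + p := by exact_mod_cast hp
      linarith
    have key := aa_int_ineq ((S.card : ℤ) - 2 * e) k hpar
    rw [he]
    exact_mod_cast key
  have hε2 : ∀ y, ε y ^ 2 = 1 := fun y => by rcases hε y with h | h <;> rw [h] <;> norm_num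
  calc (2 * k + 2 : ℝ) * ∑ x : Fin m → Bool, |∑ y ∈ S, ε y * twist x y|
      = ∑ x : Fin m → Bool, (2 * k + 2 : ℝ) * |∑ y ∈ S, ε y * twist x y| := mul_sum _ _ _
    _ ≤ ∑ x : Fin m → Bool, ((∑ y ∈ S, ε y * twist x y) ^ 2 + k * (k + 2)) :=
        sum_le_sum fun x _ => hpt x
    _ = (2 : ℝ) ^ m * (S.card + k * (k + 2)) := by
        rw [sum_add_distrib, aa_sum_psi_sq, sum_const, nsmul_eq_mul, aa_card_univ,
          sum_congr rfl fun y _ => hε2 y, sum_const, nsmul_eq_mul, mul_one]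
        ring

/-- **The LP bound on the absolute Walsh mass of a set of characters**: for `±1`-valued `g` and `|S| + k` even,
`(2k+2) ∑_{y∈S} |W_g(y)| ≤ 2^m (|S| + k(k+2))`: with `ε_y = sign W_g(y)`,
`∑_S |W_g| = ∑_x g(x) ψ(x) ≤ ∑_x |ψ(x)|` for `ψ(x) = ∑_{y∈S} ε_y (-1)^{x·y}`, then `aa_sum_abs_psi_le`. [folklore] -/
theorem aa_sum_abs_W_le {m : ℕ} (g : (Fin m → Bool) → ℝ) (hg : ∀ x, g x = 1 ∨ g x = -1)
    (S : Finset (Fin m → Bool)) (k : ℕ) (hk : Even (S.card + k)) :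
    (2 * k + 2 : ℝ) * ∑ y ∈ S, |W g y| ≤ (2 : ℝ) ^ m * (S.card + k * (k + 2)) := by
  -- the signs `ε_y` with `|W_g(y)| = ε_y W_g(y)`
  have hε : ∀ y, (if 0 ≤ W g y then (1 : ℝ) else -1) = 1 ∨ (if 0 ≤ W g y then (1 : ℝ) else -1) = -1 :=
    fun y => by split_ifs <;> simp
  have habs : ∀ y, |W g y| = (if 0 ≤ W g y then (1 : ℝ) else -1) * W g y := fun y => by
    split_ifs with h
    · rw [abs_of_nonneg h, one_mul]
    · rw [abs_of_neg (not_le.1 h)]; ring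
  have hswap : ∑ y ∈ S, |W g y| =
      ∑ x, g x * ∑ y ∈ S, (if 0 ≤ W g y then (1 : ℝ) else -1) * twist x y := by
    calc ∑ y ∈ S, |W g y| = ∑ y ∈ S, ∑ x, (if 0 ≤ W g y then (1 : ℝ) else -1) * (g x * twist x y) := by
          refine sum_congr rfl fun y _ => ?_
          rw [habs, W, mul_sum]
      _ = ∑ x, ∑ y ∈ S, (if 0 ≤ W g y then (1 : ℝ) else -1) * (g x * twist x y) := sum_comm
      _ = ∑ x, g x * ∑ y ∈ S, (if 0 ≤ W g y then (1 : ℝ) else -1) * twist x y := by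
          refine sum_congr rfl fun x _ => ?_
          rw [mul_sum]
          exact sum_congr rfl fun y _ => by ring
  have hle : ∑ y ∈ S, |W g y| ≤ ∑ x, |∑ y ∈ S, (if 0 ≤ W g y then (1 : ℝ) else -1) * twist x y| := by
    rw [hswap]
    refine sum_le_sum fun x _ => ?_
    have hg1 : |g x| = 1 := by rcases hg x with h | h <;> rw [h] <;> norm_num
    calc g x * ∑ y ∈ S, (if 0 ≤ W g y then (1 : ℝ) else -1) * twist x y
        ≤ |g x * ∑ y ∈ S, (if 0 ≤ W g y then (1 : ℝ) else -1) * twist x y| := le_abs_self _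
      _ = |∑ y ∈ S, (if 0 ≤ W g y then (1 : ℝ) else -1) * twist x y| := by rw [abs_mul, hg1, one_mul]
  have hpos : (0 : ℝ) ≤ 2 * k + 2 := by positivity
  exact (mul_le_mul_of_nonneg_left hle hpos).trans (aa_sum_abs_psi_le S _ hε k hk)

/-- Parseval restricted to `S`: for `±1`-valued `g`, `∑_{y∈S} W_g(y)² ≤ ∑_y W_g(y)² = 4^m`. [folklore] -/
theorem aa_sum_W_sq_le {m : ℕ} (g : (Fin m → Bool) → ℝ) (hg : ∀ x, g x = 1 ∨ g x = -1)
    (S : Finset (Fin m → Bool)) : ∑ y ∈ S, W g y ^ 2 ≤ ((2 : ℝ) ^ m) ^ 2 := by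
  have hg2 : ∀ x, g x ^ 2 = 1 := fun x => by rcases hg x with h | h <;> rw [h] <;> norm_num
  calc ∑ y ∈ S, W g y ^ 2 ≤ ∑ y, W g y ^ 2 := sum_le_univ_sum_of_nonneg fun y => sq_nonneg _
    _ = ((2 : ℝ) ^ m) ^ 2 := by
        rw [DerivativeWalsh.sum_W_sq, sum_congr rfl fun x _ => hg2 x, sum_const, nsmul_eq_mul, mul_one,
          aa_card_univ]
        ring

/-! ### The aligned rank-2 quadratic has half-integral Walsh values -/

/-- If `(−1)^{c(x)} = (−1)^e (−1)^{s·x} (1 + U + V − UV)/2` with `U = (−1)^{u·x}`, `V = (−1)^{v·x}`, then every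
Walsh value `W_{(−1)^c}(y)` lies in `(2^m/2)·ℤ` (expand and use `∑_x (−1)^{x·z} = 2^m [z = 0]`). [folklore] -/
theorem aa_W_halfInt {m : ℕ} (c : (Fin m → Bool) → Bool) (s u v : Fin m → Bool) (e : Bool)
    (hc : ∀ x, signOf (c x) =
      signOf e * twist s x * ((1 + twist u x + twist v x - twist u x * twist v x) / 2))
    (y : Fin m → Bool) : ∃ j : ℤ, W (fun x => signOf (c x)) y = (2 : ℝ) ^ m / 2 * j := by
  have hI : ∀ z : Fin m → Bool, ∃ i : ℤ, ∑ x : Fin m → Bool, twist x z = (2 : ℝ) ^ m * i := by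
    intro z
    rw [BuzetChailloux.sum_twist_left]
    split_ifs
    · exact ⟨1, by simp⟩
    · exact ⟨0, by simp⟩
  have hε : ∃ ε : ℤ, signOf e = ε := by
    cases e
    · exact ⟨1, by simp [signOf]⟩
    · exact ⟨-1, by simp [signOf]⟩
  obtain ⟨i₁, h₁⟩ := hI (bxor s y)
  obtain ⟨i₂, h₂⟩ := hI (bxor (bxor s y) u)
  obtain ⟨i₃, h₃⟩ := hI (bxor (bxor s y) v)
  obtain ⟨i₄, h₄⟩ := hI (bxor (bxor (bxor s y) u) v)
  obtain ⟨ε, hε⟩ := hε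
  refine ⟨ε * (i₁ + i₂ + i₃ - i₄), ?_⟩
  have key : ∀ x : Fin m → Bool, signOf (c x) * twist x y =
      signOf e / 2 * (twist x (bxor s y) + twist x (bxor (bxor s y) u) + twist x (bxor (bxor s y) v) -
        twist x (bxor (bxor (bxor s y) u) v)) := by
    intro x
    rw [hc x, BuzetChailloux.twist_bxor_right x (bxor (bxor s y) u) v,
      BuzetChailloux.twist_bxor_right x (bxor s y) v, BuzetChailloux.twist_bxor_right x (bxor s y) u,
      BuzetChailloux.twist_bxor_right x s y, twist_comm s x, twist_comm u x, twist_comm v x]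
    ring
  unfold W
  rw [sum_congr rfl fun x _ => key x, ← mul_sum, sum_sub_distrib, sum_add_distrib, sum_add_distrib,
    h₁, h₂, h₃, h₄, hε]
  push_cast
  ring

/-! ### The per-fibre lemma -/

/-- **Per-fibre lemma.** Let `g` be `±1`-valued on `𝔽₂^m` (`K = 2^m`), `σ` a sign pattern, `S` a set of characters
such that ANY four distinct characters carrying absolute Walsh mass `> 15K/8` force all Walsh values of `g` into
`(K/2)ℤ` (the four-point lemma, for cubic `g`).  If the fibre cost
`K² − ∑_{y∈S} W_g(y)² + ∑_{y∈S} (σ_y W_g(y) − K/2)²` is `< K²/8` then `|S| = 4` and `σ_y W_g(y) = K/2` on `S`.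
Proof: `K ∑_S |W| ≥ ∑_S W² + |S|K²/4 − v`; the LP bound `aa_sum_abs_W_le` with `k = 1, 0, 2` excludes `|S|` odd,
`= 2`, `≥ 6` (and `|S| = 0` costs `K²`); for `|S| = 4` the mass exceeds `15K/8`, so `σW ∈ (K/2)ℤ` on `S` and every
value `≠ K/2` would cost `≥ K²/4`. [folklore] -/
theorem aa_fibre {m : ℕ} (g : (Fin m → Bool) → ℝ) (hg : ∀ x, g x = 1 ∨ g x = -1)
    (σ : (Fin m → Bool) → ℝ) (hσ : ∀ y, σ y = 1 ∨ σ y = -1) (S : Finset (Fin m → Bool))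
    (hq : ∀ y₁ y₂ y₃ y₄ : Fin m → Bool, y₁ ≠ y₂ → y₁ ≠ y₃ → y₁ ≠ y₄ → y₂ ≠ y₃ → y₂ ≠ y₄ → y₃ ≠ y₄ →
      (15 / 8 : ℝ) * (2 : ℝ) ^ m < |W g y₁| + |W g y₂| + |W g y₃| + |W g y₄| →
      ∀ y, ∃ j : ℤ, W g y = (2 : ℝ) ^ m / 2 * j)
    (hcost : ((2 : ℝ) ^ m) ^ 2 - ∑ y ∈ S, W g y ^ 2 + ∑ y ∈ S, (σ y * W g y - (2 : ℝ) ^ m / 2) ^ 2 <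
      ((2 : ℝ) ^ m) ^ 2 / 8) :
    S.card = 4 ∧ ∀ y ∈ S, σ y * W g y = (2 : ℝ) ^ m / 2 := by
  have hKpos : (0 : ℝ) < (2 : ℝ) ^ m := by positivity
  have hPar := aa_sum_W_sq_le g hg S
  have hV0 : 0 ≤ ∑ y ∈ S, (σ y * W g y - (2 : ℝ) ^ m / 2) ^ 2 := sum_nonneg fun y _ => sq_nonneg _
  -- (i) `∑_S W² + |S| K²/4 − v ≤ K · ∑_S |W|`
  have hi : ∑ y ∈ S, W g y ^ 2 + S.card * (((2 : ℝ) ^ m) ^ 2 / 4) -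
      ∑ y ∈ S, (σ y * W g y - (2 : ℝ) ^ m / 2) ^ 2 ≤ (2 : ℝ) ^ m * ∑ y ∈ S, |W g y| := by
    have hpt : ∀ y ∈ S, W g y ^ 2 + ((2 : ℝ) ^ m) ^ 2 / 4 - (σ y * W g y - (2 : ℝ) ^ m / 2) ^ 2 ≤
        (2 : ℝ) ^ m * |W g y| := by
      intro y _
      rcases hσ y with h | h
      · rw [h, one_mul]
        have h1 : (2 : ℝ) ^ m * W g y ≤ (2 : ℝ) ^ m * |W g y| :=
          mul_le_mul_of_nonneg_left (le_abs_self _) hKpos.le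
        nlinarith [h1]
      · rw [h, neg_one_mul]
        have h1 : (2 : ℝ) ^ m * (-W g y) ≤ (2 : ℝ) ^ m * |W g y| :=
          mul_le_mul_of_nonneg_left (neg_le_abs _) hKpos.le
        nlinarith [h1]
    have := sum_le_sum hpt
    rw [sum_sub_distrib, sum_add_distrib, sum_const, nsmul_eq_mul, ← mul_sum] at this
    exact this
  -- (iii) `|S| = 4`
  have hn4 : S.card = 4 := by
    rcases Nat.even_or_odd S.card with hev | hodd
    · obtain ⟨p, hp⟩ := hev
      rcases (show p = 0 ∨ p = 1 ∨ p = 2 ∨ 3 ≤ p by omega) with rfl | rfl | rfl | hp3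
      · -- `S = ∅`: the cost is `K²`
        exfalso
        have hS : S = ∅ := card_eq_zero.1 hp
        rw [hS, sum_empty, sum_empty] at hcost
        nlinarith [hKpos]
      · -- `|S| = 2`: `∑_S |W| ≤ K`
        exfalso
        have h2 := aa_sum_abs_W_le g hg S 0 (by rw [hp]; exact ⟨1, rfl⟩)
        have hc : (S.card : ℝ) = 2 := by rw [hp]; norm_num
        rw [hc] at hi h2
        push_cast at h2
        nlinarith [h2, hi, hcost, hPar]
      · exact hp
      · -- `|S| ≥ 6` even: `6 ∑_S |W| ≤ K(|S| + 8)`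
        exfalso
        have h6 := aa_sum_abs_W_le g hg S 2 (by rw [hp]; exact ⟨p + 1, by ring⟩)
        push_cast at h6
        have hp6 : 6 ≤ S.card := by omega
        have hc6 : (6 : ℝ) ≤ S.card := by exact_mod_cast hp6
        have hcK : (6 : ℝ) * ((2 : ℝ) ^ m) ^ 2 ≤ S.card * ((2 : ℝ) ^ m) ^ 2 :=
          mul_le_mul_of_nonneg_right hc6 (sq_nonneg _)
        nlinarith [h6, hi, hcost, hPar, hcK, hKpos]
    · -- `|S|` odd: `4 ∑_S |W| ≤ K(|S| + 3)`
      exfalso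
      have h4 := aa_sum_abs_W_le g hg S 1 (hodd.add_odd odd_one)
      push_cast at h4
      nlinarith [h4, hi, hcost, hPar, hKpos]
  refine ⟨hn4, ?_⟩
  -- (iv) the mass of the four characters exceeds `15K/8`
  have hA : (15 / 8 : ℝ) * (2 : ℝ) ^ m < ∑ y ∈ S, |W g y| := by
    have hc : (S.card : ℝ) = 4 := by rw [hn4]; norm_num
    rw [hc] at hi
    by_contra hle
    push Not at hle
    nlinarith [hi, hcost, hPar, hKpos, mul_le_mul_of_nonneg_left hle hKpos.le]
  obtain ⟨y₁, t, hy₁t, hS, ht⟩ := card_eq_succ.1 hn4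
  obtain ⟨y₂, y₃, y₄, h23, h24, h34, rfl⟩ := card_eq_three.1 ht
  simp only [mem_insert, mem_singleton, not_or] at hy₁t
  obtain ⟨h12, h13, h14⟩ := hy₁t
  have hsum : ∑ y ∈ S, |W g y| = |W g y₁| + |W g y₂| + |W g y₃| + |W g y₄| := by
    rw [← hS, sum_insert (by simp [h12, h13, h14]), sum_insert (by simp [h23, h24]),
      sum_insert (by simp [h34]), sum_singleton]
    ring
  rw [hsum] at hA
  have hint := hq y₁ y₂ y₃ y₄ h12 h13 h14 h23 h24 h34 hA
  -- every `σ_y W_g(y)` on `S` is in `(K/2)ℤ`, and any value other than `K/2` costs `≥ K²/4 > v`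
  intro y hy
  obtain ⟨j, hj⟩ := hint y
  have hj' : ∃ j' : ℤ, σ y * W g y = (2 : ℝ) ^ m / 2 * j' := by
    rcases hσ y with h | h
    · exact ⟨j, by rw [h, hj]; ring⟩
    · exact ⟨-j, by rw [h, hj]; push_cast; ring⟩
  obtain ⟨j', hj'⟩ := hj'
  have hVlt : ∑ y ∈ S, (σ y * W g y - (2 : ℝ) ^ m / 2) ^ 2 < ((2 : ℝ) ^ m) ^ 2 / 8 := by linarith
  have hterm : (σ y * W g y - (2 : ℝ) ^ m / 2) ^ 2 ≤ ∑ y ∈ S, (σ y * W g y - (2 : ℝ) ^ m / 2) ^ 2 :=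
    single_le_sum (f := fun y => (σ y * W g y - (2 : ℝ) ^ m / 2) ^ 2) (fun y _ => sq_nonneg _) hy
  by_contra hne
  have hj1 : j' ≠ 1 := by
    rintro rfl
    exact hne (by rw [hj']; push_cast; ring)
  have hsq : (1 : ℤ) ≤ (j' - 1) ^ 2 := by
    have := Int.one_le_abs (sub_ne_zero.2 hj1)
    nlinarith [abs_nonneg (j' - 1), sq_abs (j' - 1)]
  have hsqR : (1 : ℝ) ≤ ((j' : ℝ) - 1) ^ 2 := by exact_mod_cast hsq
  rw [hj'] at hterm
  nlinarith [hterm, hVlt, hsqR, hKpos, mul_le_mul_of_nonneg_left hsqR (sq_nonneg ((2 : ℝ) ^ m / 2))]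

/-- **Per-fibre lemma, registered helper-stub form** of `aa_fibre` (sub-goal `aa_fibreStub` of stub `stub_ammAccounting`,
line `direct-sum-amplification`): a fibre of cost `< K²/8` has exactly four characters, all carrying `σW = K/2`. [folklore] -/
theorem aa_fibreStub : ∀ {m : ℕ} (g : (Fin m → Bool) → ℝ), (∀ x, g x = 1 ∨ g x = -1) → ∀ (σ : (Fin m → Bool) → ℝ), (∀ y, σ y = 1 ∨ σ y = -1) → ∀ (S : Finset (Fin m → Bool)), (∀ y₁ y₂ y₃ y₄ : Fin m → Bool, y₁ ≠ y₂ → y₁ ≠ y₃ → y₁ ≠ y₄ → y₂ ≠ y₃ → y₂ ≠ y₄ → y₃ ≠ y₄ → (15 / 8 : ℝ) * (2 : ℝ) ^ m < |W g y₁| + |W g y₂| + |W g y₃| + |W g y₄| → ∀ y, ∃ j : ℤ, W g y = (2 : ℝ) ^ m / 2 * j) → ((2 : ℝ) ^ m) ^ 2 - ∑ y ∈ S, W g y ^ 2 + ∑ y ∈ S, (σ y * W g y - (2 : ℝ) ^ m / 2) ^ 2 < ((2 : ℝ) ^ m) ^ 2 / 8 → S.card = 4 ∧ ∀ y ∈ S,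 σ y * W g y = (2 : ℝ) ^ m / 2 :=
  fun g hg σ hσ S hq hcost => aa_fibre g hg σ hσ S hq hcost

end Summit.QuantumAdvantage.QuantumAdvantage.Theorems.CubicForrelation.NearExactIsExact
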